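import Summits.QuantumAdvantage.QuantumAdvantage.Theorems.RingSparseActive

/-!
# Sparse-active strategies lose the ring game — part 4: tightness (the pointer strategy)

The degree hypothesis of the sparse law (part 3, `sparse_active_loses`) is LOAD-BEARING: the POINTER strategy — the
canonical guess `t` corrected on outputs `0` and `1` only (flip output `0` when position `0` is visible in the trace form,
else output `1`; positions `0`, `1` are never both invisible) — wins EVERY odd pattern for every `N ≥ 3`
(`pointer_perfect`), with at most two active outputs (`card_activeSet_pointerStrat`).  Hence the degree-free sparse
law fails at `K = 2` (`not_sparseLose_degreeFree`), and the sparse law becomes an Ω(N) DEGREE LOWER BOUND: every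
2-sparse perfect correction of the canonical guess uses an output of `𝔽₃`-degree `> (N − 53)/288`
(`degree_lb_of_twoSparse_perfect`, `pointerStrat_degree_lb`).  Degree-free dichotomy `degreeFree_dichotomy`: one active
output always loses (`single_active_loses`, single-zero patterns, `N ≥ 7`), two can win (`N ≥ 3`).
Source: decomp-qadv lens 2, generation 8 (node «SparseDial», critic row 42's question).
-/

set_option linter.dupNamespace false -- D-0017: single-problem summit ⇒ QuantumAdvantage.QuantumAdvantage by design

namespace Summit.QuantumAdvantage.QuantumAdvantage.Theorems.RingSparseActive

open Finset Literature.Computability.MetaComplexity Literature.Computability.MetaComplexity.Smolensky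

/-! ## Stage 5: tightness — the pointer strategy -/

section Tight

open Summit.QuantumAdvantage.AdviceFreeQNC0 Literature.Computability.QuantumComplexity
  Literature.Computability.QuantumComplexity.RingHLF

variable {N : ℕ}

/-- Position `0` is VISIBLE at `x`: its trace-form residue `(0 + N + W_0 + W) mod 3` is not `2` (`W_0 = 0`). -/
def vis0 (x : Fin N → Bool) : Bool := decide ((N + Wk x (N - 1)) % 3 ≠ 2)

/-- Flip pattern of the POINTER strategy: flip output `0` when position `0` is visible, else flip output `1`
(positions `0` and `1` are never both invisible: their residues differ by `1 + [u_0] ∈ {1, 2}`). -/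
def pointerFlip (x : Fin N → Bool) (k : Fin N) : Bool :=
  if k.val = 0 then vis0 x else if k.val = 1 then !vis0 x else false

/-- The POINTER strategy (NO degree bound; its two corrected outputs read the whole walk `W(x)`): the
canonical guess `t` corrected on outputs `0` and `1` only. -/
def pointerStrat (N : ℕ) : Fin N → CubeFn (ZMod 3) N := fun k x =>
  if xor (tGuess x k) (pointerFlip x k) = true then 1 else 0

/-- Output bits of the pointer strategy. -/
theorem zOut_pointerStrat (x : Fin N → Bool) (k : Fin N) :
    zOut (pointerStrat N) x k = xor (tGuess x k) (pointerFlip x k) := by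
  unfold zOut pointerStrat
  cases xor (tGuess x k) (pointerFlip x k) <;> decide

/-- `(a ⊕ b) ⊕ a = b`. -/
theorem xor_xor_cancel_left (a b : Bool) : xor (xor a b) a = b := by
  cases a <;> cases b <;> rfl

/-- `W_1 ∈ {0, 1}`. -/
theorem Wk_one_le (hN : 1 ≤ N) (x : Fin N → Bool) : Wk x 1 ≤ 1 := by
  rw [Wk_succ x (show 0 < N by omega), Wk_zero]; split <;> simp

/-- **The pointer strategy WINS EVERY ODD PATTERN**, for every `N ≥ 3` (trace form: exactly one visible flip). -/
theorem pointer_perfect (hN : 3 ≤ N) (x : Fin N → Bool) (hx : OddZeros x) :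
    Rel x (zOut (pointerStrat N) x) := by
  rw [traceForm hN x hx]
  have hW1 := Wk_one_le (show 1 ≤ N by omega) x
  have key : (univ.filter fun k : Fin N => xor (zOut (pointerStrat N) x k) (tGuess x k) = true ∧
      (k.val + N + Wk x k.val + Wk x (N - 1)) % 3 ≠ 2) =
      {if vis0 x = true then (⟨0, by omega⟩ : Fin N) else ⟨1, by omega⟩} := by
    ext k
    simp only [mem_filter, mem_univ, true_and, mem_singleton, zOut_pointerStrat, xor_xor_cancel_left]
    constructor
    · rintro ⟨hflip, hres⟩
      unfold pointerFlip at hflip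
      split_ifs at hflip with h0 h1
      · simp [Fin.ext_iff, hflip, h0]
      · have hv : vis0 x = false := by simpa using hflip
        simp [Fin.ext_iff, hv, h1]
    · intro hk
      split_ifs at hk with hv
      · subst hk
        refine ⟨by simp [pointerFlip, hv], ?_⟩
        have hv' := hv; unfold vis0 at hv'; rw [decide_eq_true_eq] at hv'
        simp only [Wk_zero]; intro h; apply hv'; omega
      · subst hk
        have hvf : vis0 x = false := by simpa using hv
        refine ⟨by simp [pointerFlip, hvf], ?_⟩
        unfold vis0 at hvf
        rw [decide_eq_false_iff_not, not_not] at hvf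
        intro h
        change (1 + N + Wk x 1 + Wk x (N - 1)) % 3 = 2 at h
        omega
  rw [key, card_singleton]

/-- The pointer strategy deviates from the canonical guess only at outputs `0` and `1`. -/
theorem activeSet_pointerStrat_subset (hN : 2 ≤ N) :
    activeSet (pointerStrat N) ⊆ {(⟨0, by omega⟩ : Fin N), ⟨1, by omega⟩} := by
  intro k hk
  rw [mem_activeSet] at hk
  obtain ⟨x, -, hne⟩ := hk
  rw [zOut_pointerStrat] at hne
  simp only [mem_insert, mem_singleton]
  by_contra h
  push Not at h
  apply hne
  have h0 : k.val ≠ 0 := fun e => h.1 (Fin.ext e)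
  have h1 : k.val ≠ 1 := fun e => h.2 (Fin.ext e)
  simp [pointerFlip, h0, h1]

/-- The pointer strategy has at most two active outputs. -/
theorem card_activeSet_pointerStrat (hN : 2 ≤ N) : (activeSet (pointerStrat N)).card ≤ 2 :=
  (card_le_card (activeSet_pointerStrat_subset hN)).trans (card_insert_le _ _)

/-- **TIGHTNESS: the degree hypothesis of the sparse law is load-bearing.**  The degree-free sparse law is
FALSE already at `K = 2`: for every `N ≥ 3` there is a strategy with `≤ 2` active outputs that wins every odd
pattern (degree-free `2`-sparse perfect corrections exist for all `N ≥ 3`). -/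
theorem not_sparseLose_degreeFree :
    ¬ (∃ N₁ : ℕ, ∀ N ≥ N₁, ∀ P : Fin N → CubeFn (ZMod 3) N, (activeSet P).card ≤ 2 →
        ∃ x : Fin N → Bool, OddZeros x ∧ ¬ Rel x (zOut P x)) := by
  rintro ⟨N₁, h⟩
  obtain ⟨x, hx, hrel⟩ := h (max N₁ 3) (le_max_left _ _) (pointerStrat _)
    (card_activeSet_pointerStrat (by have := le_max_right N₁ 3; omega))
  exact hrel (pointer_perfect (le_max_right _ _) x hx)

/-- **An Ω(N) DEGREE LOWER BOUND from the game.**  For `N ≥ 288d + 53`, one of the two corrected outputs of the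
pointer strategy has `𝔽₃`-degree `> d` (as a function on `{0,1}^N`): otherwise the sparse law (`K = 2`) would make
it lose somewhere, contradicting `pointer_perfect`.  Equivalently: every 2-sparse perfect correction of the
canonical guess uses an output of degree `> (N − 53)/288`. -/
theorem pointerStrat_degree_lb (d N : ℕ) (hN : 3 * (24 * (2 * (d + d)) + 17) + 2 ≤ N) :
    ∃ k ∈ activeSet (pointerStrat N), pointerStrat N k ∉ lowDeg (ZMod 3) N d := by
  by_contra h
  push Not at h
  obtain ⟨x, hx, hrel⟩ := sparse_active_loses d 2 N hN (pointerStrat N) h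
    (card_activeSet_pointerStrat (by omega))
  exact hrel (pointer_perfect (by omega) x hx)

/-- The same for ANY 2-sparse perfect strategy: one of its active outputs has degree `> d` once `N ≥ 288d+53`. -/
theorem degree_lb_of_twoSparse_perfect (d N : ℕ) (hN : 3 * (24 * (2 * (d + d)) + 17) + 2 ≤ N)
    (P : Fin N → CubeFn (ZMod 3) N) (hcard : (activeSet P).card ≤ 2)
    (hperf : ∀ x : Fin N → Bool, OddZeros x → Rel x (zOut P x)) :
    ∃ k ∈ activeSet P, P k ∉ lowDeg (ZMod 3) N d := by
  by_contra h
  push Not at h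
  obtain ⟨x, hx, hrel⟩ := sparse_active_loses d 2 N hN P h hcard
  exact hrel (hperf x hx)

/-! ### Degree-free `K = 1`: a single active output is invisible on some single-zero pattern -/

/-- The SINGLE-ZERO pattern: `x_i = 1` except `x_j = 0`. -/
def sz (N j : ℕ) : Fin N → Bool := fun i => decide (i.val ≠ j)

/-- Unfolding lemma for `sz`. -/
theorem sz_apply (j : ℕ) (i : Fin N) : sz N j i = decide (i.val ≠ j) := rfl

/-- Zero-parities of the single-zero pattern: `zpar (sz j) k = [j < k]`. -/
theorem zpar_sz {j : ℕ} (hj : j < N) : ∀ {k : ℕ}, k ≤ N → zpar (sz N j) k = decide (j < k)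
  | 0, _ => by rw [zpar_zero]; simp
  | k + 1, h => by
    rw [zpar_succ _ (show k < N by omega), zpar_sz hj (Nat.le_of_succ_le h), sz_apply]
    by_cases hjk : j < k
    · have h1 : j < k + 1 := by omega
      have h2 : k ≠ j := by omega
      simp [hjk, h1, h2]
    · by_cases hkj : k = j
      · subst hkj; simp
      · have h1 : ¬ j < k + 1 := by omega
        simp [hjk, h1, hkj]

/-- Walk sums of the single-zero pattern: `W_k = k − j` (truncated). -/
theorem Wk_sz {j : ℕ} (hj : j < N) : ∀ {k : ℕ}, k ≤ N → Wk (sz N j) k = k - j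
  | 0, _ => by rw [Wk_zero]; simp
  | k + 1, h => by
    rw [Wk_succ _ (show k < N by omega), Wk_sz hj (Nat.le_of_succ_le h), uCoord_eq_zpar,
      zpar_sz hj (show k + 1 ≤ N by omega)]
    by_cases hjk : j < k + 1
    · simp [hjk]; omega
    · simp [hjk]; omega

/-- The single-zero pattern lies in the odd class. -/
theorem oddZeros_sz {j : ℕ} (hj : j < N) : OddZeros (sz N j) := by
  unfold OddZeros
  have : (univ.filter fun b : Fin N => sz N j b = false) = {⟨j, hj⟩} := by
    ext b; simp [sz_apply, Fin.ext_iff]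
  rw [this, card_singleton]

/-- **One active output never suffices (no degree bound needed)**  For `N ≥ 7`, a strategy whose active set is
contained in a single position `k` loses on a single-zero pattern at which `k` is invisible. -/
theorem single_active_loses (hN : 7 ≤ N) (P : Fin N → CubeFn (ZMod 3) N) (k : Fin N)
    (hS : activeSet P ⊆ {k}) : ∃ x : Fin N → Bool, OddZeros x ∧ ¬ Rel x (zOut P x) := by
  -- the zero goes right after `k` (distance `1 + r`) if there is room, else before it
  set r := (2 * N + 2) % 3 with hr
  set j := if k.val + 4 ≤ N then k.val + 1 + r else k.val - 1 - r with hj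
  have hjN : j < N := by
    rw [hj]; split_ifs <;> omega
  refine ⟨sz N j, oddZeros_sz hjN, ?_⟩
  rw [traceForm (by omega) (sz N j) (oddZeros_sz hjN)]
  have key : (univ.filter fun i : Fin N => xor (zOut P (sz N j) i) (tGuess (sz N j) i) = true ∧
      (i.val + N + Wk (sz N j) i.val + Wk (sz N j) (N - 1)) % 3 ≠ 2) = ∅ := by
    ext i
    simp only [mem_filter, mem_univ, true_and, Finset.notMem_empty, iff_false, not_and, not_not]
    intro hflip
    have hi : i ∈ activeSet P := by
      rw [mem_activeSet]
      refine ⟨sz N j, oddZeros_sz hjN, ?_⟩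
      intro h; rw [h, Bool.xor_self] at hflip; exact Bool.false_ne_true hflip
    have hik : i = k := by simpa using hS hi
    subst hik
    rw [Wk_sz hjN (show i.val ≤ N by omega), Wk_sz hjN (show N - 1 ≤ N by omega)]
    have hi2 := i.isLt
    rw [hj]
    split_ifs with h4 <;> omega
  rw [key, card_empty]
  decide

/-- **THE DEGREE-FREE DICHOTOMY** (no Prop-valued defs in this library file; the node's `sparseLoseFree_iff`):
with no degree bound on the active outputs, (i) at most ONE active output ⇒ the strategy loses (`N ≥ 7`), while
(ii) TWO active outputs can win every odd pattern (`N ≥ 3`, the pointer strategy). -/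
theorem degreeFree_dichotomy :
    (∀ N ≥ 7, ∀ P : Fin N → CubeFn (ZMod 3) N, (activeSet P).card ≤ 1 →
        ∃ x : Fin N → Bool, OddZeros x ∧ ¬ Rel x (zOut P x)) ∧
    (∀ N ≥ 3, ∃ P : Fin N → CubeFn (ZMod 3) N, (activeSet P).card ≤ 2 ∧
        ∀ x : Fin N → Bool, OddZeros x → Rel x (zOut P x)) := by
  refine ⟨fun N hN P hcard => ?_, fun N hN => ⟨pointerStrat N, card_activeSet_pointerStrat (by omega),
    pointer_perfect hN⟩⟩
  haveI : Nonempty (Fin N) := ⟨⟨0, by omega⟩⟩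
  obtain ⟨k, hk⟩ := Finset.card_le_one_iff_subset_singleton.mp hcard
  exact single_active_loses (by omega) P k hk

end Tight

end Summit.QuantumAdvantage.QuantumAdvantage.Theorems.RingSparseActive
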